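import Summits.KontsevichZagierPeriods.Zeta5Search.CasoratianValuation
import HarnessLib

/-!
# ζ(5) search — the `S₇`-gauge form of Brown–Zudilin (28)+(30) for `Pₙ` (census §15.6), OBSERVED — SKETCH v2 (census g12; cone amended by census g13 after gen-2 g9's review)

HONEST FRAMING: systematic search; no irrationality claim unless certified.

Cell `pub-zeta5`, census seat g12 (statement agreed with the lead's routing note 2026-08-20T11:12Z item 4; to be
filed by the lead / typer lane, co-owned with gen-2 g9).  v2 (census g13, 2026-08-20): the cone hypothesis is
`d(b) ≤ 2·m₅(b)` (gen-2 g9's review 13:05Z, see REGIME below) instead of v1's `d(b) ≤ 2·m₁(b)`, under which BOTH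
statements were false off the named rays; nothing else changed.  NOTHING here is proved except two definitional
sanity lemmas; `SymmetricGaugeLaw` and `GaugeLaw28` are statements MINTED BY THIS CELL (`@[conjecture]`), the
dual-side rewriting of Brown–Zudilin's experimental inclusion (28) and its `G`-average (29)–(30)
(arXiv:2210.03391v3, Sect. 7, p. 20) for the constant term `P = ρ·Cas` of the cellular linear form under the
wedge dictionary (`WedgeDictionary.wedgeDictionary`, `XSave.POf`).

THE DICTIONARY.  On the dual side the Brown–Zudilin group `G ≅ S₇` acts by PERMUTING the seven lower
parameters `b₁,…,b₇` (`CellularGroup.closure_eq_top` and `genI1_aOf`…: the generators act on the symmetric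
coordinates by transpositions generating `S₇`; census `orbit.py`: the orbit of the record direction is exactly the
5 040 permutations of `(17,…,11)`, all convergent with dual vector in the polytope).  The 28 linear forms `h_i(a)`
of (26) are, at `b = b(a)`, the multiset `H(b) = {b_i : 1 ≤ i ≤ 7} ∪ {b₀ − b_j − b_k : 1 ≤ j < k ≤ 7}` (`forms28`), so
BZ's `D_n = d_{m₁n}⋯d_{m₅n}` has `v_p(D_n) = Σ_{i≤5} ⌊log_p m_i(b)⌋` with `m₁ ≥ … ≥ m₅` the five largest elements of
`H(b)` (`eD`).  The canonical coefficients `U, W, V` — hence the Casoratian `Cas_j(b) = W(b+e_j)V(b) − W(b)V(b+e_j)`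
(`CasoratianValuation.casoratian`) — are SYMMETRIC under `S₇` (the summand `R_b` is), while the closed scalar
`ρ` (`WedgeDictionary.rhoOf`, here as a function `rhoB` of the dual vector, `rhoOf a = rhoB (bOfA a)` by `rfl`) is
NOT: `ρ(σ•b)/ρ(b)` is BZ's factorial ratio `∏_{i∈F}(g hᵢ)!/∏_{i∈F} hᵢ!`.  Hence (28) for the direction `g·a`
reads `v_p(ρ(σ•b)) + v_p(Cas_j(b)) ≥ −v_p(D_n)`, and (28)+(29)+(30) for `Pₙ` is ONE SYMMETRIC LAW for the symmetric
object `Cas_j(b)`: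

  (BZ-GAUGE)   `v_p(Cas_j(b)) ≥ −e_D(b,p) − min_{σ ∈ S₇} v_p(ρ(σ•b))`      (`p ≥ 5`, `p² > m₁(b)`),

stated below as `∀ σ` (equivalent to the minimum).  (28) alone is the case `σ = 1` (`GaugeLaw28`), where BZ do
not restrict `p`.

EVIDENCE (census g12 `gaugecheck.py`, exact arithmetic, `j` = index of the least parameter, all primes
`3 ≤ p ≤ 3b₀+8`): rays of NEAR-MISSES rows 1–6 (`β₀ ∈ {39,41,44,50}`), `n ≤ 6`: 3 182 instances, 0 violations at
`p ≥ 5` (3 085 of them TIGHT — equality), and on the totally symmetric ray `b = n·(3;1⁷)`, `n ≤ 40`: 1 656 instances,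
0 violations at `p ≥ 5`.  AT `p = 3` BOTH forms FAIL by exactly one: the `σ`-minimum fails at `p = 3 < √m₁` on rows
2–5 (`n = 1, 3`; (28) itself holds there — this is why BZ restrict `Φₙ` to `p > √(m₁n)`), and (28) ITSELF fails at
`p = 3` on the symmetric ray at `n ∈ {2, 6, 8, 18, 20, 24, 26}` (`n = 2` is the cell's `XSave.cornerThree`); hence
`5 ≤ p`, as in every law of `CasoratianValuation`.  REGIME (v2).  (28) is refuted on the cone `d > 2m₁`
(`XSave.XS2_failsBeyondTwiceM1`, `witness28`: there `v_p(ρ(σ•b)) = −v_p(d!) = −2` for every `σ` at a prime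
`m₁ < p ≤ d/2` while `v_p(Cas) = 1`), AND ALREADY ON `d > 2m₅` INSIDE THE D-WINDOW (gen-2 g9, review 2026-08-20T13:05Z,
`pub-zeta5-gen-2/g9/gauge_*.py`: 28 exact witnesses in 12,029 random `(b, j, p)` with `b₀ ≤ 36` under v1's guard
`d ≤ 2m₁`, margin always exactly 1 — e.g. `b = (15; 4,4,3,3,3,1,0)`, `j = 5`, `p = 13`: `d = 27`, top five forms
`(14,12,12,12,11)`, `e_D = 1`, `v₁₃(Cas₅(b)) = 0`, `min_σ v₁₃(ρ(σ•b)) = −2`; mechanism: a prime `m₅ < p ≤ m₁` with `2p ≤ d`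
exposes `v_p(ρ(σ*•b)) = −v_p(d!) = −2` while `D` pays only `e_D ∈ {1,2}`; every witness reproduced by census g13's
independent engine `code/census/g13/gaugecone.py`).  Hence both statements carry the hypothesis `d(b) ≤ 2·m₅(b)`
(`m5` = the fifth largest of the 28 forms = the least modulus of BZ's `D`), which forces `2p > d` for every D-window
prime; with it: 0 violations of the `σ`-form and of (28) at random relabellings in ≈14,000 in-cone instances (gen-2 g9,
`b₀ ≤ 46`) and in census g13's run (module `EVIDENCE v2` line below).  NAMED RAYS: record `25 ≤ 32`, rows 2–6
`27 ≤ 34`, `31 ≤ 38`, `28 ≤ 34`, `33 ≤ 38`, `20 ≤ 32`, g8 #1 `64 ≤ 72`, `(34;14,…,8)` `25 ≤ 28`, W6 `162 ≤ 176`, and WITH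
EQUALITY X1 `50 = 50`, X2 `42 = 42`, X3 `46 = 46`, `1⁸` `2 = 2` — all inside (per unit `n`; the cone is homogeneous).
LABELLING: `Cas_j`, `e_D`, `m₁`, `m₅`, `d`, `InPolytope` are `S₇`-invariant and `ρ` is not, so (28) at the relabelled
vector `σ•b` IS the `σ`-instance of the gauge law: "σ = 1" (`GaugeLaw28`) is not a canonical gauge — on
sorted-descending `b` it never failed in either sample, on randomly relabelled `b` it fails exactly where the `σ`-form
does (v1 cone) and nowhere in the v2 cone.  The guard `≠ 0` avoids the junk value `padicValRat p 0 = 0`.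
EVIDENCE v2 (census g13 `gaugecone.py`, exact, random RELABELLED `b` in the polytope, random admissible `j`, all primes
`5 ≤ p ≤ 3b₀+8`): see `pub-zeta5-census/xsave/g13/gaugecone_*.json` — instances / violations / tight are quoted in
STRUCTURE.md §17 next to this file's sha.

WHY THIS FORM (census §15.6–15.7).  Every denominator theorem for `Pₙ` in the tree (Lemma 19 / BigPrime* = rung T,
cluster bounds = rung K, THEOREM LB, LB♯♯) bounds `v_p(Cas_j)` by a SYMMETRIC but TERMWISE function of the class
data; on the record ray their union certifies 58.830 nats/step (53.083 with LB♯♯ and BZ's D-part) against BZ's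
49.606; the whole gap is (BZ-GAUGE) on the atlas cells of §15.4 (in the best gauge `σ*` the D-part alone is the
truth: cell A = `RecordCellA`).  A proof of `SymmetricGaugeLaw` on the record ray (with `Zeta3`-side analogue) is
exactly what turns BZ's Theorem 1 exponent into a certificate.
-/

namespace Summit.KontsevichZagierPeriods.Zeta5Search.SymmetricGauge

open Finset
open Summit.KontsevichZagierPeriods.Zeta5Search.CasoratianValuation (casoratian shift InPolytope)
open Summit.KontsevichZagierPeriods.Zeta5Search.WedgeDictionary (rhoOf dOf Epairs)
open Literature.NumberTheory.Irrationality.BrownZudilin2022 (bOfA)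

/-- gen-1's closed scalar as a function of the DUAL vector:
`ρ(b) = (−1)^{Σ_j b_j} ∏_{(j,k)∈E} (b₀−b_j−b_k)! / (4 · b₁! b₄! b₅! b₆! b₇! · d(b)!)` (same expression as `WedgeDictionary.rhoOf`). -/
def rhoB (b : ℕ → ℤ) : ℚ :=
  (-1 : ℚ) ^ (∑ j ∈ range 7, b (j + 1)).toNat *
      ((Epairs.map fun jk => ((b 0 - b jk.1 - b jk.2).toNat.factorial : ℚ)).prod) /
    (4 * (([1, 4, 5, 6, 7] : List ℕ).map fun j => ((b j).toNat.factorial : ℚ)).prod *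
      ((dOf b).toNat.factorial : ℚ))

/-- `rhoOf a` IS `rhoB` at `b = b(a)` (definitional). -/
theorem rhoOf_eq_rhoB (a : Fin 8 → ℤ) : rhoOf a = rhoB (bOfA a) := rfl

/-- The `S₇`-action on dual vectors: `(σ • b)_i = b_{σ(i)}` for `1 ≤ i ≤ 7` (indices `i ↔ σ`-slot `i−1`), `b₀` and
everything outside `[1,7]` fixed. -/
def permLower (σ : Equiv.Perm (Fin 7)) (b : ℕ → ℤ) : ℕ → ℤ := fun i =>
  if h : 1 ≤ i ∧ i ≤ 7 then b ((σ ⟨i - 1, by omega⟩ : Fin 7).val + 1) else b i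

/-- Brown–Zudilin's 28 linear forms on the dual side: the seven lower parameters and the 21 pair complements
`b₀ − b_j − b_k` (a list with multiplicity). -/
def forms28 (b : ℕ → ℤ) : List ℤ :=
  ((List.range 7).map fun i => b (i + 1)) ++
    (List.range 7).flatMap fun j => ((List.range 7).filter fun k => j < k).map fun k => b 0 - b (j + 1) - b (k + 1)

/-- `m₁(b)` = the largest of the 28 forms. -/
def m1 (b : ℕ → ℤ) : ℤ := (forms28 b).foldr max 0

/-- `m₅(b)` = the fifth largest of the 28 forms (with multiplicity) = the least modulus of Brown–Zudilin's
`D = d_{m₁}⋯d_{m₅}`; the v2 cone is `d(b) ≤ 2·m₅(b)` (gen-2 g9). -/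
def m5 (b : ℕ → ℤ) : ℤ := ((forms28 b).insertionSort (· ≥ ·)).getD 4 0

/-- `e_D(b,p) = v_p(d_{m₁} d_{m₂} d_{m₃} d_{m₄} d_{m₅})`, `m₁ ≥ … ≥ m₅` the five largest of the 28 forms (with
multiplicity), `d_N = lcm(1,…,N)` so that `v_p(d_N) = ⌊log_p N⌋` (`Nat.log`). -/
def eD (b : ℕ → ℤ) (p : ℕ) : ℤ :=
  ((((forms28 b).insertionSort (· ≥ ·)).take 5).map fun m => (Nat.log p m.toNat : ℤ)).sum

/-- **(BZ-GAUGE), OBSERVED — the `S₇`-gauge form of (28)+(29)+(30) for `Pₙ`.**  For `b` in the polytope with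
`d(b) ≤ 2m₅(b)` (v2), a contiguity index `j` keeping `b + e_j` in the polytope, a prime `p ≥ 5` with `p² > m₁(b)`, and EVERY
`σ ∈ S₇`:  `v_p(Cas_j(b)) ≥ −e_D(b,p) − v_p(ρ(σ • b))`.  Evidence and the `p = 3` / `d > 2m₅` exclusions: module docstring. -/
@[conjecture] def SymmetricGaugeLaw : Prop :=
  ∀ (b : ℕ → ℤ) (j p : ℕ) (σ : Equiv.Perm (Fin 7)),
    InPolytope b → 1 ≤ j → j ≤ 7 → InPolytope (shift b j) → dOf b ≤ 2 * m5 b →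
    p.Prime → 5 ≤ p → m1 b < (p : ℤ) ^ 2 → casoratian b j ≠ 0 →
      -eD b p - padicValRat p (rhoB (permLower σ b)) ≤ padicValRat p (casoratian b j)

/-- **(28) for `Pₙ` on the dual side, OBSERVED** (the case `σ = 1`, no restriction `p² > m₁`):
`v_p(Cas_j(b)) ≥ −e_D(b,p) − v_p(ρ(b))`, i.e. `D · P ∈ ℤ_(p)` for `P = ρ(b)·Cas_j(b)`, `p ≥ 5`, `d(b) ≤ 2m₅(b)` (v2; for
EVERY labelling of `b₁,…,b₇` — see LABELLING in the module docstring). -/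
@[conjecture] def GaugeLaw28 : Prop :=
  ∀ (b : ℕ → ℤ) (j p : ℕ),
    InPolytope b → 1 ≤ j → j ≤ 7 → InPolytope (shift b j) → dOf b ≤ 2 * m5 b →
    p.Prime → 5 ≤ p → casoratian b j ≠ 0 →
      -eD b p - padicValRat p (rhoB b) ≤ padicValRat p (casoratian b j)

/-- `GaugeLaw28` is the `σ = 1` instance of the gauge law away from the small primes `p² ≤ m₁`. -/
theorem gaugeLaw28_of_symmetric_largePrime (h : SymmetricGaugeLaw) :
    ∀ (b : ℕ → ℤ) (j p : ℕ),
      InPolytope b → 1 ≤ j → j ≤ 7 → InPolytope (shift b j) → dOf b ≤ 2 * m5 b →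
      p.Prime → 5 ≤ p → m1 b < (p : ℤ) ^ 2 → casoratian b j ≠ 0 →
        -eD b p - padicValRat p (rhoB b) ≤ padicValRat p (casoratian b j) := by
  intro b j p hb hj1 hj7 hb' hd hp h5 hm hne
  have h1 := h b j p 1 hb hj1 hj7 hb' hd hp h5 hm hne
  have e : permLower 1 b = b := by
    funext i
    unfold permLower
    split_ifs with hi
    · simp only [Equiv.Perm.coe_one, id_eq]
      congr 1; omega
    · rfl
  simpa [e] using h1

/-! ### Sanity checks on the record ray `b = (41; 17,16,15,14,13,12,11)` (BZ Sect. 11: `m = (18,17,17,16,16)`, `Σ m = 84`) -/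

/-- the record dual vector -/
def bRecord : ℕ → ℤ := fun i => (([41, 17, 16, 15, 14, 13, 12, 11] : List ℤ).getD i 0)

example : ((forms28 bRecord).insertionSort (· ≥ ·)).take 5 = [18, 17, 17, 16, 16] := by decide
example : m1 bRecord = 18 := by decide
example : m5 bRecord = 16 := by decide
/-- the record is inside the v2 cone: `d = 25 ≤ 32 = 2m₅`. -/
example : dOf bRecord = 25 ∧ dOf bRecord ≤ 2 * m5 bRecord := by decide

/-- NEAR-MISSES row X1 `(61; 22,…,16)` lies ON THE BOUNDARY of the v2 cone: `d = 50 = 2m₅`. -/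
def bX1 : ℕ → ℤ := fun i => (([61, 22, 21, 20, 19, 18, 17, 16] : List ℤ).getD i 0)
example : dOf bX1 = 50 ∧ m5 bX1 = 25 := by decide

/-- gen-2 g9's first witness against the v1 cone, `b = (15; 4,4,3,3,3,1,0)` (`d = 27`, `m₁ = 14`, `m₅ = 11`): inside
`d ≤ 2m₁`, OUTSIDE `d ≤ 2m₅`. -/
def bW1 : ℕ → ℤ := fun i => (([15, 4, 4, 3, 3, 3, 1, 0] : List ℤ).getD i 0)
example : dOf bW1 = 27 ∧ m1 bW1 = 14 ∧ m5 bW1 = 11 ∧ dOf bW1 ≤ 2 * m1 bW1 ∧ ¬ dOf bW1 ≤ 2 * m5 bW1 := by decide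
/-- `e_D` at `p = 5` on the record at `n = 1`: `⌊log₅ 18⌋ + 2⌊log₅ 17⌋ + 2⌊log₅ 16⌋ = 5`. -/
example : eD bRecord 5 = 5 := by decide
/-- `e_D` at `p = 17`: `d₁₈, d₁₇, d₁₇` contain `17`, `d₁₆` does not: `3`. -/
example : eD bRecord 17 = 3 := by decide
/-- the best gauge of cell A (census §15.6): `σ* b = (41; 11,12,13,16,17,15,14)` is a `permLower` image. -/
example : ∃ σ : Equiv.Perm (Fin 7), ∀ i ∈ range 8,
    permLower σ bRecord i = (([41, 11, 12, 13, 16, 17, 15, 14] : List ℤ).getD i 0) := by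
  -- `σ = (1↦7, 2↦6, 3↦5, 4↦2, 5↦1, 6↦3, 7↦4)` on indices, i.e. on `Fin 7`: `![6,5,4,1,0,2,3]` with inverse `![4,3,5,6,2,1,0]`
  refine ⟨⟨![6, 5, 4, 1, 0, 2, 3], ![4, 3, 5, 6, 2, 1, 0], by decide, by decide⟩, ?_⟩
  decide

end Summit.KontsevichZagierPeriods.Zeta5Search.SymmetricGauge
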